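import Summits.AtomisticToContinuum.Crystallization.Theorems.OverbindingBudgetAffineFarFieldCellAffine
import Literature.Geometry.DiscreteGeometry.SphericalWedgeVolume

/-!
# Overbinding budget — far field, part 27V-F2 «FrameTransport»: chart transport along registered paths

Route `OverbindingBudget`, crux `RobustDefectLimitWindows` (stmt-31280), line (2c), leaf SW♭(30),
part 27V-F (the FRAME LEDGER of DESK27V-g94 §3 (L)), piece F2 — ATLAS-FREE.  The two largest rows of
the far-field column (DENSITY = E_vol and ρ·CORE = INTERFACE, 79 % of the base) rest on transporting
a mover's chart `(y_p, M_p := ν_p A_p)` from the hub `p₀` along a REGISTERED PATH `p₀, p₁, …, p_L` of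
bonds.  Piece F1 (atlas-bound, later) supplies the PER-BOND hypotheses; this file turns them into the
PATH clauses with CLOSED-FORM accumulation in the binders `(c, τ, η, L)`, over an abstract path
(sequences indexed by `ℕ`, bonds `k → k+1` for `k < L`; no atlas, no lattice):

* §1 MATRIX clause.  Absolute steps `‖M (k+1) − M k‖ ≤ c` ⇒ `‖M L − M 0‖ ≤ L·c` (linear row);
  relative steps `‖M (k+1) − M k‖ ≤ c‖M k‖` ⇒ `‖M L‖ ≤ (1+c)^L ‖M 0‖` and
  `‖M L − M 0‖ ≤ ((1+c)^L − 1)‖M 0‖` (HONEST compounding), with the linearisation remainder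
  `(1+c)^L − 1 − L·c ≤ L·c·((1+c)^L − 1)` booked as its own row, the exact exponential form
  `(1+c)^L − 1 ≤ L·c·exp (L·c)` and the side condition `L·c ≤ 1/2 ⇒ (1+c)^L − 1 ≤ 2·L·c` for the
  linear row.
* §2 POSITION clause.  Steps `y (k+1) = y k + M k (t k) + e k` with template bond vectors
  `‖t k‖ ≤ τ` and misplacements `‖e k‖ ≤ η` ⇒
  `‖(y L − y 0) − M 0 (Σ_{k<L} t k)‖ ≤ τ·Σ_{k<L} ‖M k − M 0‖ + L·η ≤ c·τ·L(L−1)/2 + L·η`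
  (the desk's `û(L) = εL + c₂L²`, `c₂ = cτ/2`).
* §3 DETERMINANT clause (volume of charted cells, `|K| = |det A|·|K₀|` by `volume_image_affMap_toReal`):
  on `ℝ³`, `‖A‖ ≤ b ⇒ |det A| ≤ b³` and `(∀ u, a‖u‖ ≤ ‖A u‖), 0 ≤ a ⇒ a³ ≤ |det A|` (Haar measure of the
  images of balls — sharp, no Hadamard constant), hence along a path `(a₀ − Lc)³ ≤ |det M_L| ≤ (‖M 0‖ + Lc)³`,
  and for a conformal chart `|⟪Au, Aw⟫ − λ²⟪u, w⟫| ≤ mλ²‖u‖‖w‖` (CellVoronoi's `hB`):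
  `a² ≤ (1−m)λ², (1+m)λ² ≤ b² ⇒ a³ ≤ |det A| ≤ b³`.

Cited by name: `Literature.Geometry.DiscreteGeometry.volume_ball_toReal_pos`, Mathlib's
`Measure.addHaar_image_continuousLinearMap`, `Measure.addHaar_closedBall`, `dist_le_range_sum_dist`.
Must-fails (check/mf): dropping the hypothesis on ONE bond of the path kills §1 (MF18); dropping the
misplacement row `L·η` kills §2 (MF19).
-/

namespace Summit.AtomisticToContinuum.Crystallization.Theorems.OverbindingBudgetAffineFarFieldFrameTransport

noncomputable section

open MeasureTheory Metric Literature.Geometry.DiscreteGeometry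

local notation "E3" => EuclideanSpace ℝ (Fin 3)

/-! ## §1 Matrix clause: transport along the path -/

section Transport

variable {G : Type*} [SeminormedAddCommGroup G]

/-- LINEAR ROW: absolute per-bond steps `≤ c` accumulate to `≤ L·c` along a path of `L` bonds
(generic normed group — here the chart matrices; the `E3`-valued special case is
`ChartedZeroExcessLayeredLatticeLiouvilleWL.norm_sub_le_of_steps`). -/
theorem transport_linear (M : ℕ → G) {c : ℝ} {L : ℕ} (h : ∀ k < L, ‖M (k + 1) - M k‖ ≤ c) :
    ‖M L - M 0‖ ≤ L * c := by
  have h0 := dist_le_range_sum_dist M L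
  rw [dist_comm, dist_eq_norm] at h0
  refine h0.trans ?_
  calc ∑ k ∈ Finset.range L, dist (M k) (M (k + 1)) ≤ ∑ k ∈ Finset.range L, c :=
        Finset.sum_le_sum fun k hk => by
          rw [dist_comm, dist_eq_norm]; exact h k (Finset.mem_range.1 hk)
    _ = L * c := by simp

/-- The linear row at every site of the path: `‖M k − M 0‖ ≤ k·c` for `k ≤ L`. -/
theorem transport_linear_le (M : ℕ → G) {c : ℝ} {L : ℕ} (h : ∀ k < L, ‖M (k + 1) - M k‖ ≤ c)
    {k : ℕ} (hk : k ≤ L) : ‖M k - M 0‖ ≤ k * c :=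
  transport_linear M fun j hj => h j (lt_of_lt_of_le hj hk)

/-- HONEST COMPOUNDING: relative per-bond steps `≤ c‖M k‖` give `‖M k‖ ≤ (1+c)^k ‖M 0‖` and
`‖M k − M 0‖ ≤ ((1+c)^k − 1)‖M 0‖` at every site `k ≤ L`. -/
theorem transport_compound_le (M : ℕ → G) {c : ℝ} (hc : 0 ≤ c) {L : ℕ}
    (h : ∀ k < L, ‖M (k + 1) - M k‖ ≤ c * ‖M k‖) :
    ∀ k ≤ L, ‖M k‖ ≤ (1 + c) ^ k * ‖M 0‖ ∧ ‖M k - M 0‖ ≤ ((1 + c) ^ k - 1) * ‖M 0‖ := by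
  intro k hk
  induction k with
  | zero => simp
  | succ k ih =>
    obtain ⟨h1, h2⟩ := ih (Nat.le_of_succ_le hk)
    have hs := h k hk
    have hpow : 0 ≤ (1 + c) ^ k := pow_nonneg (by linarith) k
    have e1 : M (k + 1) = (M (k + 1) - M k) + M k := by abel
    have e2 : M (k + 1) - M 0 = (M (k + 1) - M k) + (M k - M 0) := by abel
    have hstep : ‖M (k + 1) - M k‖ ≤ c * ((1 + c) ^ k * ‖M 0‖) :=
      hs.trans (mul_le_mul_of_nonneg_left h1 hc)
    constructor
    · rw [e1]
      refine (norm_add_le _ _).trans ?_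
      rw [pow_succ]
      nlinarith [hstep, h1]
    · rw [e2]
      refine (norm_add_le _ _).trans ?_
      rw [pow_succ]
      nlinarith [hstep, h2]

/-- Honest compounding at the end of the path. -/
theorem transport_compound (M : ℕ → G) {c : ℝ} (hc : 0 ≤ c) {L : ℕ}
    (h : ∀ k < L, ‖M (k + 1) - M k‖ ≤ c * ‖M k‖) : ‖M L - M 0‖ ≤ ((1 + c) ^ L - 1) * ‖M 0‖ :=
  (transport_compound_le M hc h L le_rfl).2

/-- The geometric accumulation is at most `L·c·(1+c)^L`. -/
theorem compound_sub_one_le (c : ℝ) (hc : 0 ≤ c) (L : ℕ) : (1 + c) ^ L - 1 ≤ L * c * (1 + c) ^ L := by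
  induction L with
  | zero => simp
  | succ L ih =>
    have hpow : 1 ≤ (1 + c) ^ L := one_le_pow₀ (by linarith)
    have hpow' : 0 ≤ (1 + c) ^ L := by linarith
    rw [pow_succ, Nat.cast_succ]
    nlinarith [ih, mul_nonneg hc hpow', mul_nonneg (mul_nonneg (Nat.cast_nonneg L) hc) hpow']

/-- LINEARISATION REMAINDER ROW: `(1+c)^L − 1 − L·c ≤ L·c·((1+c)^L − 1)`. -/
theorem compound_remainder_le (c : ℝ) (hc : 0 ≤ c) (L : ℕ) :
    (1 + c) ^ L - 1 - L * c ≤ L * c * ((1 + c) ^ L - 1) := by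
  have := compound_sub_one_le c hc L
  nlinarith

/-- The compounding factor is at most `exp (L·c)`. -/
theorem compound_le_exp (c : ℝ) (hc : 0 ≤ c) (L : ℕ) : (1 + c) ^ L ≤ Real.exp (L * c) := by
  rw [Real.exp_nat_mul]
  exact pow_le_pow_left₀ (by linarith) (by linarith [Real.add_one_le_exp c]) L

/-- Exact exponential form of the accumulation: `(1+c)^L − 1 ≤ L·c·exp (L·c)`. -/
theorem compound_sub_one_le_exp (c : ℝ) (hc : 0 ≤ c) (L : ℕ) :
    (1 + c) ^ L - 1 ≤ L * c * Real.exp (L * c) :=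
  (compound_sub_one_le c hc L).trans
    (mul_le_mul_of_nonneg_left (compound_le_exp c hc L) (mul_nonneg (Nat.cast_nonneg L) hc))

/-- SIDE CONDITION FOR THE LINEAR ROW: if `L·c ≤ 1/2` then `(1+c)^L − 1 ≤ 2·(L·c)` (since
`exp (1/2) < 2`); the desk regime has `L·c ≤ 41 · 3·10⁻⁴ ≈ 1.2·10⁻²`. -/
theorem compound_sub_one_le_two_mul (c : ℝ) (hc : 0 ≤ c) (L : ℕ) (h : L * c ≤ 1 / 2) :
    (1 + c) ^ L - 1 ≤ 2 * (L * c) := by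
  have hLc : 0 ≤ (L : ℝ) * c := mul_nonneg (Nat.cast_nonneg L) hc
  have h1 := compound_sub_one_le_exp c hc L
  have h2 : Real.exp (L * c) ≤ Real.exp (1 / 2) := Real.exp_le_exp.2 h
  have h3 : Real.exp (1 / 2) < 2 := by
    have h4 : Real.exp (1 / 2) * Real.exp (1 / 2) = Real.exp 1 := by
      rw [← Real.exp_add]; norm_num
    nlinarith [Real.exp_one_lt_d9, Real.exp_pos (1 / 2 : ℝ)]
  nlinarith [mul_nonneg hLc (Real.exp_pos ((L : ℝ) * c)).le]

end Transport

/-! ## §2 Position clause -/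

section Position

variable {E : Type*} [NormedAddCommGroup E] [NormedSpace ℝ E]

/-- Telescoping of the bond steps. -/
theorem position_telescope (M : ℕ → E →L[ℝ] E) (y t e : ℕ → E) {L : ℕ}
    (hstep : ∀ k < L, y (k + 1) = y k + M k (t k) + e k) :
    y L - y 0 = ∑ k ∈ Finset.range L, (M k (t k) + e k) := by
  induction L with
  | zero => simp
  | succ L ih =>
    rw [Finset.sum_range_succ, ← ih fun k hk => hstep k (Nat.lt_succ_of_lt hk),
      hstep L (Nat.lt_succ_self L)]
    abel

/-- POSITION CLAUSE (general form): the end of the path sits at the hub chart's prediction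
`y 0 + M 0 (Σ t k)` up to `τ·Σ‖M k − M 0‖ + L·η`. -/
theorem position_clause (M : ℕ → E →L[ℝ] E) (y t e : ℕ → E) {τ η : ℝ} {L : ℕ}
    (hstep : ∀ k < L, y (k + 1) = y k + M k (t k) + e k) (ht : ∀ k < L, ‖t k‖ ≤ τ)
    (he : ∀ k < L, ‖e k‖ ≤ η) :
    ‖y L - y 0 - M 0 (∑ k ∈ Finset.range L, t k)‖
      ≤ τ * ∑ k ∈ Finset.range L, ‖M k - M 0‖ + L * η := by
  have hτ : ∀ k < L, 0 ≤ τ := fun k hk => (norm_nonneg _).trans (ht k hk)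
  rw [position_telescope M y t e hstep, map_sum, ← Finset.sum_sub_distrib]
  have hterm : ∀ k ∈ Finset.range L,
      ‖M k (t k) + e k - M 0 (t k)‖ ≤ τ * ‖M k - M 0‖ + η := by
    intro k hk
    have hk' := Finset.mem_range.1 hk
    have e1 : M k (t k) + e k - M 0 (t k) = (M k - M 0) (t k) + e k := by
      rw [sub_apply]; abel
    rw [e1]
    refine (norm_add_le _ _).trans (add_le_add ?_ (he k hk'))
    refine ((M k - M 0).le_opNorm (t k)).trans ?_
    rw [mul_comm]
    exact mul_le_mul_of_nonneg_right (ht k hk') (norm_nonneg _)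
  refine (norm_sum_le _ _).trans ((Finset.sum_le_sum hterm).trans ?_)
  rw [Finset.sum_add_distrib, Finset.mul_sum]
  simp

/-- `Σ_{k<L} k = L(L−1)/2` over `ℝ`. -/
theorem gauss_sum_range_real (L : ℕ) : ∑ k ∈ Finset.range L, (k : ℝ) = L * ((L : ℝ) - 1) / 2 := by
  induction L with
  | zero => simp
  | succ L ih => rw [Finset.sum_range_succ, ih, Nat.cast_succ]; ring

/-- POSITION CLAUSE (closed form): with the linear matrix row `‖M k − M 0‖ ≤ k·c` along the path,
`‖(y L − y 0) − M 0 (Σ t k)‖ ≤ c·τ·L(L−1)/2 + L·η` — the desk's `û(L) = εL + c₂L²`, `c₂ = cτ/2`. -/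
theorem position_clause_closed (M : ℕ → E →L[ℝ] E) (y t e : ℕ → E) {c τ η : ℝ} {L : ℕ}
    (hstep : ∀ k < L, y (k + 1) = y k + M k (t k) + e k) (ht : ∀ k < L, ‖t k‖ ≤ τ)
    (he : ∀ k < L, ‖e k‖ ≤ η) (hM : ∀ k < L, ‖M (k + 1) - M k‖ ≤ c) :
    ‖y L - y 0 - M 0 (∑ k ∈ Finset.range L, t k)‖
      ≤ c * τ * (L * ((L : ℝ) - 1) / 2) + L * η := by
  refine (position_clause M y t e hstep ht he).trans (add_le_add ?_ le_rfl)
  rcases Nat.eq_zero_or_pos L with hL | hL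
  · subst hL; simp
  have hτ : 0 ≤ τ := (norm_nonneg _).trans (ht 0 hL)
  have hsum : ∑ k ∈ Finset.range L, ‖M k - M 0‖ ≤ ∑ k ∈ Finset.range L, (k : ℝ) * c :=
    Finset.sum_le_sum fun k hk => transport_linear_le M hM (Finset.mem_range.1 hk).le
  rw [← Finset.sum_mul, gauss_sum_range_real] at hsum
  nlinarith [hsum, hτ]

end Position

/-! ## §3 Determinant clause on `ℝ³` -/

/-- Volume scaling of closed balls in `ℝ³`: `|B̄(0, r)| = r³ · |B(0, 1)|` (`0 ≤ r`). [folklore] -/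
theorem volume_closedBall_three (r : ℝ) (hr : 0 ≤ r) :
    volume (closedBall (0 : E3) r) = ENNReal.ofReal (r ^ 3) * volume (ball (0 : E3) 1) := by
  rw [Measure.addHaar_closedBall _ _ hr, finrank_euclideanSpace_fin]

/-- `‖A‖ ≤ b ⇒ |det A| ≤ b³` on `ℝ³` (the image of the unit ball lies in the ball of radius `‖A‖`). -/
theorem abs_det_le_pow (A : E3 →L[ℝ] E3) {b : ℝ} (hb : ‖A‖ ≤ b) : |A.det| ≤ b ^ 3 := by
  have hsub : (A : E3 → E3) '' closedBall 0 1 ⊆ closedBall 0 ‖A‖ := by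
    rintro _ ⟨u, hu, rfl⟩
    rw [mem_closedBall_zero_iff] at hu ⊢
    exact (A.le_opNorm u).trans (mul_le_of_le_one_right (norm_nonneg _) hu)
  have hle := measure_mono (μ := volume) hsub
  rw [Measure.addHaar_image_continuousLinearMap, volume_closedBall_three 1 zero_le_one, one_pow,
    ENNReal.ofReal_one, one_mul, volume_closedBall_three _ (norm_nonneg _)] at hle
  have hfin : ENNReal.ofReal (‖A‖ ^ 3) * volume (ball (0 : E3) 1) ≠ ⊤ :=
    ENNReal.mul_ne_top ENNReal.ofReal_ne_top measure_ball_lt_top.ne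
  have h2 := ENNReal.toReal_mono hfin hle
  rw [ENNReal.toReal_mul, ENNReal.toReal_mul, ENNReal.toReal_ofReal (abs_nonneg _),
    ENNReal.toReal_ofReal (by positivity)] at h2
  exact (le_of_mul_le_mul_right h2 (volume_ball_toReal_pos (E := E3))).trans
    (pow_le_pow_left₀ (norm_nonneg _) hb 3)

/-- `(∀ u, a‖u‖ ≤ ‖A u‖), 0 ≤ a ⇒ a³ ≤ |det A|` on `ℝ³` (the ball of radius `a` lies in the image of the
unit ball). -/
theorem pow_le_abs_det (A : E3 →L[ℝ] E3) {a : ℝ} (ha : 0 ≤ a) (h : ∀ u, a * ‖u‖ ≤ ‖A u‖) :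
    a ^ 3 ≤ |A.det| := by
  rcases ha.eq_or_lt with rfl | ha0
  · simp [abs_nonneg]
  have hinj : Function.Injective (A : E3 →ₗ[ℝ] E3) := by
    intro u u' huu'
    have h1 : A (u - u') = 0 := by
      rw [map_sub]; exact sub_eq_zero.2 huu'
    have h2 := h (u - u')
    rw [h1, norm_zero] at h2
    have h3 : ‖u - u'‖ ≤ 0 := by nlinarith [norm_nonneg (u - u')]
    exact sub_eq_zero.1 (norm_le_zero_iff.1 h3)
  have hsurj : Function.Surjective (A : E3 →ₗ[ℝ] E3) := LinearMap.injective_iff_surjective.1 hinj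
  have hsub : closedBall (0 : E3) a ⊆ (A : E3 → E3) '' closedBall 0 1 := by
    intro v hv
    obtain ⟨u, hu⟩ := hsurj v
    refine ⟨u, ?_, hu⟩
    rw [mem_closedBall_zero_iff] at hv ⊢
    have h1 := h u
    rw [show A u = v from hu] at h1
    nlinarith
  have hle := measure_mono (μ := volume) hsub
  rw [Measure.addHaar_image_continuousLinearMap, volume_closedBall_three 1 zero_le_one, one_pow,
    ENNReal.ofReal_one, one_mul, volume_closedBall_three _ ha] at hle
  have hfin : ENNReal.ofReal |A.det| * volume (ball (0 : E3) 1) ≠ ⊤ :=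
    ENNReal.mul_ne_top ENNReal.ofReal_ne_top measure_ball_lt_top.ne
  have h2 := ENNReal.toReal_mono hfin hle
  rw [ENNReal.toReal_mul, ENNReal.toReal_mul, ENNReal.toReal_ofReal (abs_nonneg _),
    ENNReal.toReal_ofReal (by positivity)] at h2
  exact le_of_mul_le_mul_right h2 (volume_ball_toReal_pos (E := E3))

/-- Lower norms survive transport: `a‖u‖ ≤ ‖M₀ u‖` and `‖M − M₀‖ ≤ δ` give `(a − δ)‖u‖ ≤ ‖M u‖`. -/
theorem lower_norm_of_near {E : Type*} [NormedAddCommGroup E] [NormedSpace ℝ E] (M M₀ : E →L[ℝ] E)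
    {a δ : ℝ} (h0 : ∀ u, a * ‖u‖ ≤ ‖M₀ u‖) (hd : ‖M - M₀‖ ≤ δ) (u : E) :
    (a - δ) * ‖u‖ ≤ ‖M u‖ := by
  have h1 : ‖(M - M₀) u‖ ≤ δ * ‖u‖ := ((M - M₀).le_opNorm u).trans
    (mul_le_mul_of_nonneg_right hd (norm_nonneg _))
  have h2 : ‖M₀ u‖ ≤ ‖M u‖ + ‖(M - M₀) u‖ := by
    have e : M₀ u = M u - (M - M₀) u := by rw [sub_apply]; abel
    rw [e]; exact norm_sub_le _ _
  nlinarith [h0 u, h1, h2]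

/-- DETERMINANT CLAUSE ALONG A PATH: with the linear matrix row, at every site `k ≤ L`
`(a − kc)³ ≤ |det (M k)| ≤ (‖M 0‖ + kc)³`, `a` a lower norm of the hub chart with `kc ≤ a`. -/
theorem det_clause_of_steps (M : ℕ → E3 →L[ℝ] E3) {a c : ℝ} {L : ℕ}
    (h0 : ∀ u, a * ‖u‖ ≤ ‖M 0 u‖) (h : ∀ k < L, ‖M (k + 1) - M k‖ ≤ c) {k : ℕ} (hk : k ≤ L)
    (hak : k * c ≤ a) :
    (a - k * c) ^ 3 ≤ |(M k).det| ∧ |(M k).det| ≤ (‖M 0‖ + k * c) ^ 3 := by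
  have hd := transport_linear_le M h hk
  refine ⟨pow_le_abs_det (M k) (by linarith) (lower_norm_of_near (M k) (M 0) h0 hd), ?_⟩
  refine abs_det_le_pow (M k) ?_
  have : ‖M k‖ ≤ ‖M 0‖ + ‖M k - M 0‖ := by
    have e : M k = M 0 + (M k - M 0) := by abel
    exact (congrArg norm e).le.trans (norm_add_le _ _)
  linarith

/-- DETERMINANT CLAUSE OF A CONFORMAL CHART (CellVoronoi's `hB`): `a² ≤ (1−m)λ²`, `(1+m)λ² ≤ b²`,
`0 ≤ a, b` ⇒ `a³ ≤ |det A| ≤ b³`. -/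
theorem det_clause_of_conformal (A : E3 →L[ℝ] E3) {lam m a b : ℝ}
    (hB : ∀ u w : E3, |inner ℝ (A u) (A w) - lam ^ 2 * inner ℝ u w| ≤ m * lam ^ 2 * ‖u‖ * ‖w‖)
    (ha0 : 0 ≤ a) (ha : a ^ 2 ≤ (1 - m) * lam ^ 2) (hb0 : 0 ≤ b) (hb : (1 + m) * lam ^ 2 ≤ b ^ 2) :
    a ^ 3 ≤ |A.det| ∧ |A.det| ≤ b ^ 3 := by
  have hsq : ∀ u : E3, (1 - m) * lam ^ 2 * ‖u‖ ^ 2 ≤ ‖A u‖ ^ 2 ∧ ‖A u‖ ^ 2 ≤ (1 + m) * lam ^ 2 * ‖u‖ ^ 2 := by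
    intro u
    have h1 := hB u u
    rw [real_inner_self_eq_norm_sq, real_inner_self_eq_norm_sq] at h1
    constructor <;> nlinarith [abs_le.1 h1, norm_nonneg u]
  have hroot : ∀ x y : ℝ, 0 ≤ x → 0 ≤ y → x ^ 2 ≤ y ^ 2 → x ≤ y := by
    intro x y hx hy hxy
    rw [← Real.sqrt_sq hx, ← Real.sqrt_sq hy]
    exact Real.sqrt_le_sqrt hxy
  refine ⟨pow_le_abs_det A ha0 fun u => ?_, abs_det_le_pow A ?_⟩
  · refine hroot _ _ (mul_nonneg ha0 (norm_nonneg u)) (norm_nonneg _) ?_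
    rw [mul_pow]
    nlinarith [(hsq u).1, sq_nonneg ‖u‖]
  · refine ContinuousLinearMap.opNorm_le_bound A hb0 fun u => ?_
    refine hroot _ _ (norm_nonneg _) (mul_nonneg hb0 (norm_nonneg u)) ?_
    rw [mul_pow]
    nlinarith [(hsq u).2, sq_nonneg ‖u‖]

end

end Summit.AtomisticToContinuum.Crystallization.Theorems.OverbindingBudgetAffineFarFieldFrameTransport
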